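import Literature.MathematicalPhysics.QuantumFieldTheory.Balaban1983to89.B8Ineq192FlatTorus

/-!
# `Balaban1983to89.B9Ineq349FlatTorus` — T. Bałaban, *Propagators for lattice gauge theories in a background field*, Commun.
# Math. Phys. **99** (1985) 389–434 [Balaban1985BackgroundPropagators], **(3.49)** p. 399 «|P(x,x′)|, |(DP)_μ(x,x′)|, |(PD\*)_ν(x,x′)|,
# |(DPD\*)_{μν}(x,x′)| ≦ O(1)[1, (Lʲη)⁻¹, (Lʲη)⁻¹, (Lʲη)⁻²](L^{j′}η)^{−d}e^{−½δ₀d(y,y′)}» for `P = I − R = G′Q′\*(Q′G′²Q′\*)⁻¹Q′G′` ((3.25))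
# **AT U = 1 ON THE ONE-SCALE TORUS, HYPOTHESIS-FREE, ALL FOUR ENTRIES, FOR THE GENUINE OPERATORS** — p. 399: «This way the
# theorems are reduced to the corresponding theorems for propagators without external gauge field. They were proved in [4].»

statement-level skeleton of published theorems with citation tags; proofs where landed; nothing here is a claim about the Yang–Mills mass gap

PDF held: `paper:balaban1985-cmp99-background-propagators` (journal page = PDF page + 388); pp. 391, 394, 397–399 [PDF 3, 6, 9–11] from the
text layer (`lit read … --grep`, p0003/p0006/p0011 re-read this session) and the cell's earlier image reads of the renders
`run/shared/lean/pub/pub-balaban/b2b-balaban-ref1/pages/…background-propagators…-p009/p010-x2.png` (modules `B9Ineq349`, `B8Ineq192Op`).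

CITATION HEADER (lean-in-tree rule).  Cell `lit-balaban` (HOME `run/shared/lean/pub/lit-balaban/`), unit `lit-balaban-r05` gen 16 (B8
reader/typer; free-target protocol G.5-34(d), TAKING HOME/STATUS 2026-08-22T02:4xZ, courtesy instance in the B9 block — owner r06, whose
rows B9.Eq3.49 / B9.Eq3.25 keep their heads: the general-background (3.49) is r06's abstract-letter theorem `B9Ineq349Hom.ineq349_hom` /
`B9Ineq349.ineq349_kernel`, with Theorems 3.1/3.2 as hypotheses of printed shape).  WHAT IS REPRODUCED = the display (3.49) in the
simplest geometry of the paper — ONE scale (the constant domain sequence, all blocks unit-lattice blocks, `Lʲη = L^{j′}η = 1`) at the flat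
background U = 1, scalar fibre — for the GENUINE operators of the tower-torus lineage: `G′ = G′_K = Δ′_a⁻¹ = (B1RG242Torus.tower P a m²).G K`,
`Q′ = Qk P K`, `Q′* = Qks P K`, `(Q′G′²Q′*)⁻¹ = (B6QGGQInvTowerTorus.qggqK P a m²)⁻¹`, `D = ∂^η` (`B1RG242Torus.deriv P 0 P.eps μ`, the
covariant derivative (3.3) at U = 1), `D* = ∂^{ηT}` (the adjoint for the natural scalar product, p. 391; on the uniform fine torus the adjoint
matrix is the transpose).  The printed mechanism «using again Lemma 2.1» from Theorems 3.1/3.2 is realised with their flat predecessors,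
which the tree holds HYPOTHESIS-FREE on this family ([4] of the paper = [Balaban1984PropagatorsII] = B6): Prop. 2.2 (2.67)
(`B6Prop22OneScaleTorus.entries_oneScaleTorus`, through `B8Ineq192FlatTorus.blockBounds_of_prop22`: block bounds for `G′`, `∂_μG′`), Prop. 2.3
(2.87) (`B6QGQCoerciveTowerTorus.prop23Printed_towerTorus`, through `B8Ineq192FlatTorus.cinv_decay_of_prop23`), Lemma 2.1 (2.61) in its torus
row-sum form (`B6Lemma21TowerTorus.sum_exp_T1_le`), and the symmetry of `G′` (`B6QGGQInvTowerTorus.G_transpose`).  Kind «kernel-checked proof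
of a model instance»; one definition with body (`pProjK` = the word (3.25) for P); no `… : Prop` fact; 0 sorry; inputs BY NAME.

WHAT IS PRINTED (verbatim).  p. 399 [PDF 11]: *"These theorems imply all the properties of the operator R, or DRD\*, we will need in the
future. For the operator P = I − R we obtain, using again Lemma 2.1, [|P(x, x′)|, |(DP)_μ(x, x′)|, |(PD\*)_ν(x, x′)|, |(DPD\*)_{μν}(x, x′)|] ≦
O(1)[1, (Lʲη)⁻¹, (Lʲη)⁻¹, (Lʲη)⁻²](L^{j′}η)^{−d}e^{−½δ₀d(y,y′)} for x ∈ Δ(y), y ∈ Λ_j, x′ ∈ Δ(y′), y′ ∈ Λ_{j′}. (3.49) We have also the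
corresponding bounds for Hölder norms of the kernel (DPD\*)_{μν}(x, x′). Thus the operator Δ_a is well defined."*; same page: *"This way the
theorems are reduced to the corresponding theorems for propagators without external gauge field. They were proved in [4]."*; p. 394 [PDF 6]:
*"Rf = (I − G′Q′\*(Q′G′²Q′\*)⁻¹Q′G′)f, (3.25) where G′ = G′(U) = (Δ′_a)⁻¹"*; p. 391 [PDF 3]: *"The adjoints are taken with respect to natural L²
scalar products"*; Theorem 3.1 (3.42) p. 397, Theorem 3.2 (3.48) p. 398 (verbatim in `B9.lean` / `B9Ineq349`).

WHAT THIS FILE PROVES (kernel; axioms standard).  `P : Params` (fine torus `T_η = Site P 0`, η = L^{−K}; unit torus `Site P K` = 𝔅_k), `a > 0`,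
`m² ≥ 0`; `y_x` = the K-block of the fine point `x`; `η^d = (L^d)^{−K}` (`epsPow_eq`).
* §1 `pProjK P a m²` := G′Q′\*(Q′G′²Q′\*)⁻¹·(Q′G′) — the printed word for P = I − R; `rProjK_eq_one_sub_pProjK` (R of `B8Ineq192FlatTorus` §5
  IS `1 − pProjK`), `pProjK_mul_self` (P² = P).
* §2 engine additions: `blockRowSum_le_of_blockBound` (a Prop-2.2 block bound for T gives `Σ_{w ∈ B(y′)}|T(x′, w)| ≦ Ce^{−δ|y_{x′}−y′|₁}` — test
  function = the sign pattern of the row on the block), `qk_mul_apply` (`(Q′M)(y′, c) = η^d Σ_{w∈B(y′)} M(w, c)`), `sum_exp_exp_le` (the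
  two-kernel resummation `Σ_{y′}e^{−ρ|y−y′|₁}e^{−δ|y′−y″|₁} ≦ c₀(ρ′)^d e^{−ρ′|y−y″|₁}`, `ρ′ = ½min(ρ, δ)` — Lemma 2.1 with the triangle inequality).
* §3 the factors: RIGHT `|(Q′G′)(y′, x′)| ≦ η^dCe^{−δ|y′−y_{x′}|₁}` (`abs_qkG_le`, by `G′ᵀ = G′`) and `|(Q′G′D*_ν)(y′, x′)| ≦ η^dCe^{−δ|y′−y_{x′}|₁}`
  (`abs_qkGDt_le`, by `(G′D_νᵀ)ᵀ = D_νG′`); LEFT `|(G′Q′*C⁻¹)(x, y′)|`, `|(D_μG′Q′*C⁻¹)(x, y′)| ≦ Ae^{−ρ|y_x−y′|₁}` (`left_kernel_decay`, Prop. 2.3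
  column then Prop. 2.2 once, as in `B8Ineq192FlatTorus.gPrimeQksCinv_kernel_decay`).
* §4 **`ineq349_flat`** — **(3.49) AT U = 1, ONE SCALE, NO HYPOTHESIS, ALL FOUR ENTRIES**: there are `ρ, B > 0` depending on `d, L, a, m²` only
  such that on EVERY volume of the family (`P.d = d`, `P.L = L`, every `m`, every `K ≥ 1`), for all fine points `x, x′` and directions `μ, ν`:
  `|P(x,x′)|, |(D_μP)(x,x′)|, |(PD_ν*)(x,x′)|, |(D_μPD_ν*)(x,x′)| ≦ B·η^d·e^{−ρ|y_x − y_{x′}|₁}` (matrix entries; `η^d` = the conversion between the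
  matrix and the kernel of the η^d-weighted pairing, the printed `(L^{j′}η)^{−d}` and `[1, (Lʲη)⁻¹, (Lʲη)⁻¹, (Lʲη)⁻²]` being 1 at one scale);
  `ineq349_flat_R` (the same entries for the off-identity part of R = I − P, i.e. for `R − 1`); non-vacuity of the family =
  `B8Ineq192FlatTorus.family_nonempty`.

HONEST SCOPE / NOT CLAIMED.  (i) ONE scale and U = 1 only; the general (3.49) (admissible {Ω_j}, background U with (3.35)) is r06's typed
theorem with Theorems 3.1/3.2 as hypotheses — untouched, heads unchanged.  (ii) The Hölder clause («corresponding bounds for Hölder norms of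
the kernel (DPD\*)_{μν}») is not treated.  (iii) Kernel convention: the file bounds MATRIX entries of the genuine finite matrices; the factor
`η^d` is displayed so that the statement reads as the printed kernel bound for the pairing `Σ_x η^d` (p. 391) with `(L^{j′}η)^{−d} = 1`; no other
normalisation of [4] ((3.17) weights `a_j(Lʲη)^{d−2}`) is asserted — the tower lineage absorbs block weights into `Q′ = L^{−Kd}Σ` / `Q′* =`
extension (cell DIVERGENCE D-b09.24 for the B9 carriers does not arise here).  (iv) `D*` = transpose of the forward η-difference (= its
adjoint for the uniform fine pairing); sign conventions of `∂*` play no role in absolute values.  (v) Constants existential (functions of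
`d, L, a, m²`; print: O(1) and ½δ₀ depending on d, L), rates halved at each resummation.  (vi) Value = the first hypothesis-free instance of
(3.49) in the tree, for genuine operators, complementing r06's letter calculus exactly as `B8Ineq192FlatTorus` complements `B8Ineq192Op`;
NOT summit progress, NOT continuum, NOT Clay.

RELATED IN THE TREE, NOT DUPLICATED (stem check 2026-08-22T02:4xZ: `ls Balaban1983to89 | grep -i 349` = `B9Ineq349` (kernel power counting
modulo dictionary, b2b), `B9Ineq349Hom` / `B9Ineq349PConcrete` (r06 g12: (3.49) entries from Thm 3.1/3.2 LETTERS, P written out), B12/B14/B1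
namesakes of other displays): all used or cited BY NAME, nothing restated; `B8Ineq192FlatTorus` (r05 g16: the engine, `rProjK` = I − P with
«|Rf| ≦ B′₀|f|») is the import.
-/

noncomputable section

namespace Literature.MathematicalPhysics.QuantumFieldTheory.Balaban1983to89.B9Ineq349FlatTorus

open Finset Matrix
open B1RG242Torus (tower Qk Qks deriv)
open B5Ineq137Torus (blk)
open B5DictTorusEta (GpTopIdx)
open B6Prop22OneScaleTorus (T1)
open B6Lemma21TowerTorus (T1_triangle T1_symm T1_nonneg sum_exp_T1_le)
open B6QGGQInvTowerTorus (qggqK G_transpose)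
open B8Ineq192FlatTorus (BlockBound decay_mulVec_of_blockBound blockBounds_of_prop22 cinv_decay_of_prop23 qks_mul_apply rProjK)

variable (P : Params)

/-! ## §1  The word `P = G′Q′*(Q′G′²Q′*)⁻¹Q′G′` of (3.25) on the one-scale torus -/

/-- **P = I − R = G′Q′\*(Q′G′²Q′\*)⁻¹Q′G′** ((3.25), p. 399 «For the operator P = I − R») for the GENUINE one-scale tower-torus operators at
U = 1: `G′_K·Q′_K*·(Q′_KG′_K²Q′_K*)⁻¹·(Q′_K·G′_K)`, a matrix on the fine torus `T_η = Site P 0`.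
[cite: Balaban1985BackgroundPropagators, (3.25) p.394, (3.49) p.399] -/
def pProjK (a msq : ℝ) : Matrix (Site P 0) (Site P 0) ℝ :=
  (tower P a msq).G P.K * Qks P P.K * (qggqK P a msq)⁻¹ * (Qk P P.K * (tower P a msq).G P.K)

variable {P}

/-- `R = I − P`: the projection `B8Ineq192FlatTorus.rProjK` of (3.25) IS `1 − pProjK` (definitional). [cite: Balaban1985BackgroundPropagators, (3.25) p.394, p.399] -/
theorem rProjK_eq_one_sub_pProjK (a msq : ℝ) : rProjK P a msq = 1 - pProjK P a msq := rfl

/-- **P² = P** (P = I − R with R² = R; directly: the letters `Q′G′` and `G′Q′*(Q′G′²Q′*)⁻¹` cancel, `B8Ineq192FlatTorus.qkG_mul_GQksCinv_mul`).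
[cite: Balaban1985BackgroundPropagators, (3.25) p.394, p.399] -/
theorem pProjK_mul_self {a msq : ℝ} (ha : 0 < a) (hm : 0 ≤ msq) (hK : 1 ≤ P.K) :
    pProjK P a msq * pProjK P a msq = pProjK P a msq := by
  unfold pProjK
  calc (tower P a msq).G P.K * Qks P P.K * (qggqK P a msq)⁻¹ * (Qk P P.K * (tower P a msq).G P.K) *
        ((tower P a msq).G P.K * Qks P P.K * (qggqK P a msq)⁻¹ * (Qk P P.K * (tower P a msq).G P.K))
      = (tower P a msq).G P.K * Qks P P.K * (qggqK P a msq)⁻¹ *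
          (Qk P P.K * (tower P a msq).G P.K * ((tower P a msq).G P.K * Qks P P.K * (qggqK P a msq)⁻¹ *
            (Qk P P.K * (tower P a msq).G P.K))) := by
        simp only [Matrix.mul_assoc]
    _ = _ := by rw [B8Ineq192FlatTorus.qkG_mul_GQksCinv_mul ha hm hK]

/-! ## §2  Engine additions: block row sums, the `Q′`-row of a matrix, two-kernel resummation -/

/-- `η^d = (L^d)^{−K}`: the fine cell volume of the one-scale torus (`η = ε = L^{−K}`), the weight of the pairing `Σ_x η^d`
(p. 391) and of `(Q′_Kf)(y) = L^{−Kd}Σ_{x∈B^K(y)}f(x)`. [cite: Balaban1985BackgroundPropagators, p.391; Balaban1982Higgs1, (2.11) p.609] -/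
theorem epsPow_eq (P : Params) : P.eps ^ P.d = (((P.L : ℝ) ^ P.d)⁻¹) ^ P.K := by
  rw [show P.eps = ((P.L : ℝ) ^ P.K)⁻¹ from by unfold Params.eps; rw [inv_pow]]
  rw [inv_pow, inv_pow, ← pow_mul, ← pow_mul, mul_comm P.K P.d]

/-- a matrix entry of a product is the action on a column (definitional). [folklore] -/
private theorem mul_apply_eq_mulVec {m n p : Type} [Fintype n] (M : Matrix m n ℝ) (N : Matrix n p ℝ) (x : m) (y : p) :
    (M * N) x y = (M *ᵥ fun z => N z y) x := rfl

/-- `c₀(ρ) = Σ_{z∈ℤ}e^{−ρ|z|} > 0`. [folklore] -/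
private theorem c0_pos {ρ : ℝ} (hρ : 0 < ρ) : 0 < B6.c0 ρ 1 := by
  have hs := B6Lemma21Arith.summable_c0_term (show 0 < 1 * ρ by rw [one_mul]; exact hρ)
  have h1 : Real.exp (-(1 * ρ * |((0 : ℤ) : ℝ)|)) ≤ B6.c0 ρ 1 :=
    hs.le_tsum 0 fun z _ => (Real.exp_pos _).le
  rw [Int.cast_zero, abs_zero, mul_zero, neg_zero, Real.exp_zero] at h1
  linarith

/-- **Block row sum from a block bound**: if `T` has the Prop.-2.2 block bound (constants `C`, `δ`), then for every fine point `x′` and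
block `B(y′)`: `Σ_{w∈B(y′)}|T(x′, w)| ≦ Ce^{−δ|y_{x′} − y′|₁}` — the block bound read on the test function «sign of the row, restricted to the
block» (sup norm ≦ 1). [cite: Balaban1984PropagatorsII, Prop. 2.2 (2.67) p.234; Balaban1985BackgroundPropagators, Thm 3.1 (3.42) p.397] -/
theorem blockRowSum_le_of_blockBound {T : Matrix (Site P 0) (Site P 0) ℝ} {C δ : ℝ} (hT : BlockBound P T C δ)
    (x' : Site P 0) (y' : Site P P.K) :
    ∑ w ∈ Finset.univ.filter (fun w : Site P 0 => blk P P.K w = y'), |T x' w| ≤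
      C * Real.exp (-(δ * T1 P P.K (blk P P.K x') y')) := by
  set lam : Site P 0 → ℝ := fun w => if blk P P.K w = y' then (if 0 ≤ T x' w then 1 else -1) else 0 with hlam
  have hsupp : ∀ w, lam w ≠ 0 → blk P P.K w = y' := by
    intro w hw; by_contra hne; exact hw (by simp [hlam, hne])
  have hbd : ∀ w, |lam w| ≤ 1 := by
    intro w; simp only [hlam]; split_ifs <;> simp
  have h := hT lam 1 (blk P P.K x') y' zero_le_one hsupp hbd x' rfl
  rw [mul_one] at h
  have hsum : (T *ᵥ lam) x' = ∑ w ∈ Finset.univ.filter (fun w : Site P 0 => blk P P.K w = y'), |T x' w| := by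
    simp only [Matrix.mulVec, dotProduct]
    rw [Finset.sum_filter]
    refine Finset.sum_congr rfl fun w _ => ?_
    simp only [hlam]
    split_ifs with h1 h2
    · rw [mul_one, abs_of_nonneg h2]
    · rw [mul_neg, mul_one, abs_of_neg (lt_of_not_ge h2)]
    · rw [mul_zero]
  rw [← hsum]
  exact le_trans (le_abs_self _) h

/-- **`(Q′_KM)(y′, c) = η^d Σ_{w∈B(y′)} M(w, c)`** — the K-fold block average (2.11) applied to a column (`B1RG242Torus.Qk_mulVec`).
[cite: Balaban1982Higgs1, (2.11) p.609; Balaban1985BackgroundPropagators, (3.18)–(3.19) p.393] -/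
theorem qk_mul_apply (a msq : ℝ) {n : Type} (M : Matrix (Site P 0) n ℝ) (y' : Site P P.K) (c : n) :
    (Qk P P.K * M) y' c =
      (((P.L : ℝ) ^ P.d)⁻¹) ^ P.K * ∑ w ∈ Finset.univ.filter (fun w : Site P 0 => blk P P.K w = y'), M w c := by
  rw [mul_apply_eq_mulVec]
  exact B1RG242Torus.Qk_mulVec a msq (Nat.le_add_left P.K P.m) (fun w => M w c) y'

/-- product of two decaying exponentials along `y → y′ → y″`, halved common rate: one factor carries the end-to-end distance (triangle
inequality (2.54)), the other the first leg. [folklore] -/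
private theorem exp_mul_exp_le {δ ρ d₁ d₂ d : ℝ} (hδ : 0 < δ) (hρ : 0 < ρ) (hd₁ : 0 ≤ d₁) (hd₂ : 0 ≤ d₂) (htri : d ≤ d₁ + d₂) :
    Real.exp (-(δ * d₁)) * Real.exp (-(ρ * d₂)) ≤
      Real.exp (-(min δ ρ / 2 * d)) * Real.exp (-(min δ ρ / 2 * d₁)) := by
  rw [← Real.exp_add, ← Real.exp_add]
  apply Real.exp_le_exp.mpr
  have h1 : min δ ρ ≤ δ := min_le_left _ _
  have h2 : min δ ρ ≤ ρ := min_le_right _ _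
  have h0 : 0 < min δ ρ := lt_min hδ hρ
  nlinarith [mul_nonneg h0.le hd₁, mul_nonneg h0.le hd₂, mul_le_mul_of_nonneg_right h1 hd₁,
    mul_le_mul_of_nonneg_right h2 hd₂]

/-- **Two-kernel resummation** («using again Lemma 2.1»): `Σ_{y′}e^{−ρ|y−y′|₁}e^{−δ|y′−y″|₁} ≦ c₀(ρ′)^d e^{−ρ′|y−y″|₁}`, `ρ′ = ½min(ρ, δ)` — the
triangle inequality (2.54) and the torus row sum (2.61). [cite: Balaban1984PropagatorsII, (2.54) p.232, Lemma 2.1 (2.61) p.234; Balaban1985BackgroundPropagators, p.399 («using again Lemma 2.1»)] -/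
theorem sum_exp_exp_le {ρ δ : ℝ} (hρ : 0 < ρ) (hδ : 0 < δ) (y y'' : Site P P.K) :
    ∑ y' : Site P P.K, Real.exp (-(ρ * T1 P P.K y y')) * Real.exp (-(δ * T1 P P.K y' y'')) ≤
      B6.c0 (min ρ δ / 2) 1 ^ P.d * Real.exp (-(min ρ δ / 2 * T1 P P.K y y'')) := by
  set ρ' := min ρ δ / 2 with hρ'
  have hρ'0 : 0 < ρ' := by rw [hρ']; exact div_pos (lt_min hρ hδ) two_pos
  have hrow := sum_exp_T1_le P P.K (δ₀ := ρ') (α := 1) (by rw [one_mul]; exact hρ'0) y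
  calc ∑ y' : Site P P.K, Real.exp (-(ρ * T1 P P.K y y')) * Real.exp (-(δ * T1 P P.K y' y''))
      ≤ ∑ y' : Site P P.K, Real.exp (-(ρ' * T1 P P.K y y'')) * Real.exp (-(ρ' * T1 P P.K y y')) :=
        Finset.sum_le_sum fun y' _ =>
          exp_mul_exp_le hρ hδ (T1_nonneg P P.K _ _) (T1_nonneg P P.K _ _) (T1_triangle P P.K _ _ _)
    _ = Real.exp (-(ρ' * T1 P P.K y y'')) * ∑ y' : Site P P.K, Real.exp (-(1 * ρ' * T1 P P.K y y')) := by
        rw [Finset.mul_sum]; exact Finset.sum_congr rfl fun y' _ => by rw [one_mul]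
    _ ≤ Real.exp (-(ρ' * T1 P P.K y y'')) * B6.c0 ρ' 1 ^ P.d :=
        mul_le_mul_of_nonneg_left hrow (Real.exp_nonneg _)
    _ = B6.c0 ρ' 1 ^ P.d * Real.exp (-(ρ' * T1 P P.K y y'')) := mul_comm _ _

/-! ## §3  The factors: `Q′G′`, `Q′G′D*` (right) and `G′Q′*C⁻¹`, `DG′Q′*C⁻¹` (left) -/

/-- **RIGHT factor `Q′G′`**: `|(Q′_KG′_K)(y′, x′)| ≦ η^d·C·e^{−δ|y′ − y_{x′}|₁}` — `(Q′G′)(y′,x′) = η^dΣ_{w∈B(y′)}G′(w,x′) = η^dΣ_{w∈B(y′)}G′(x′,w)`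
(G′ symmetric, `B6QGGQInvTowerTorus.G_transpose`) and the block row sum of the Prop.-2.2 bound for `G′`.
[cite: Balaban1985BackgroundPropagators, Thm 3.1 (3.42) p.397, (3.49) p.399; Balaban1984PropagatorsII, Prop. 2.2 p.234, (2.17) p.225] -/
theorem abs_qkG_le {a msq : ℝ} (ha : 0 < a) (hm : 0 ≤ msq) (hK : 1 ≤ P.K) {C δ : ℝ}
    (hG : BlockBound P ((tower P a msq).G P.K) C δ) (y' : Site P P.K) (x' : Site P 0) :
    |(Qk P P.K * (tower P a msq).G P.K) y' x'| ≤
      (((P.L : ℝ) ^ P.d)⁻¹) ^ P.K * C * Real.exp (-(δ * T1 P P.K y' (blk P P.K x'))) := by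
  rw [qk_mul_apply a msq, abs_mul, abs_of_nonneg (by positivity), mul_assoc]
  refine mul_le_mul_of_nonneg_left ?_ (by positivity)
  have hsym : ∀ w, (tower P a msq).G P.K w x' = (tower P a msq).G P.K x' w := fun w => by
    rw [← Matrix.transpose_apply ((tower P a msq).G P.K) x' w, G_transpose P ha hm hK]
  calc |∑ w ∈ Finset.univ.filter (fun w : Site P 0 => blk P P.K w = y'), (tower P a msq).G P.K w x'|
      ≤ ∑ w ∈ Finset.univ.filter (fun w : Site P 0 => blk P P.K w = y'), |(tower P a msq).G P.K w x'| :=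
        Finset.abs_sum_le_sum_abs _ _
    _ = ∑ w ∈ Finset.univ.filter (fun w : Site P 0 => blk P P.K w = y'), |(tower P a msq).G P.K x' w| :=
        Finset.sum_congr rfl fun w _ => by rw [hsym w]
    _ ≤ C * Real.exp (-(δ * T1 P P.K (blk P P.K x') y')) := blockRowSum_le_of_blockBound hG x' y'
    _ = C * Real.exp (-(δ * T1 P P.K y' (blk P P.K x'))) := by rw [T1_symm P P.K]

/-- **RIGHT factor `Q′G′D*_ν`**: `|(Q′_KG′_KD_ν*)(y′, x′)| ≦ η^d·C·e^{−δ|y′ − y_{x′}|₁}` — `(G′D_νᵀ)(w,x′) = (D_νG′)(x′,w)` (transpose, G′ symmetric)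
and the block row sum of the Prop.-2.2 bound for `∇G′`. [cite: Balaban1985BackgroundPropagators, Thm 3.1 (3.42) p.397, (3.49) p.399, p.391 (adjoints); Balaban1984PropagatorsII, Prop. 2.2 p.234] -/
theorem abs_qkGDt_le {a msq : ℝ} (ha : 0 < a) (hm : 0 ≤ msq) (hK : 1 ≤ P.K) {C δ : ℝ} (ν : Fin P.d)
    (hD : BlockBound P (deriv P 0 P.eps ν * (tower P a msq).G P.K) C δ) (y' : Site P P.K) (x' : Site P 0) :
    |(Qk P P.K * ((tower P a msq).G P.K * (deriv P 0 P.eps ν)ᵀ)) y' x'| ≤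
      (((P.L : ℝ) ^ P.d)⁻¹) ^ P.K * C * Real.exp (-(δ * T1 P P.K y' (blk P P.K x'))) := by
  rw [qk_mul_apply a msq, abs_mul, abs_of_nonneg (by positivity), mul_assoc]
  refine mul_le_mul_of_nonneg_left ?_ (by positivity)
  have hsym : ∀ w, ((tower P a msq).G P.K * (deriv P 0 P.eps ν)ᵀ) w x' =
      (deriv P 0 P.eps ν * (tower P a msq).G P.K) x' w := fun w => by
    rw [← Matrix.transpose_apply ((tower P a msq).G P.K * (deriv P 0 P.eps ν)ᵀ) x' w, Matrix.transpose_mul,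
      Matrix.transpose_transpose, G_transpose P ha hm hK]
  calc |∑ w ∈ Finset.univ.filter (fun w : Site P 0 => blk P P.K w = y'), ((tower P a msq).G P.K * (deriv P 0 P.eps ν)ᵀ) w x'|
      ≤ ∑ w ∈ Finset.univ.filter (fun w : Site P 0 => blk P P.K w = y'),
          |((tower P a msq).G P.K * (deriv P 0 P.eps ν)ᵀ) w x'| := Finset.abs_sum_le_sum_abs _ _
    _ = ∑ w ∈ Finset.univ.filter (fun w : Site P 0 => blk P P.K w = y'), |(deriv P 0 P.eps ν * (tower P a msq).G P.K) x' w| :=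
        Finset.sum_congr rfl fun w _ => by rw [hsym w]
    _ ≤ C * Real.exp (-(δ * T1 P P.K (blk P P.K x') y')) := blockRowSum_le_of_blockBound hD x' y'
    _ = C * Real.exp (-(δ * T1 P P.K y' (blk P P.K x'))) := by rw [T1_symm P P.K]

/-- **LEFT factors `G′Q′*C⁻¹` and `D_μG′Q′*C⁻¹`** (C = Q′G′²Q′\*): there are `ρ, A > 0` (functions of `d, L, a, m²`) with
`|(G′Q′*C⁻¹)(x, y′)|, |(D_μG′Q′*C⁻¹)(x, y′)| ≦ Ae^{−ρ|y_x − y′|₁}` on every volume — Prop. 2.3 (Thm 3.2's flat predecessor) for the column of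
`Q′*C⁻¹`, then Prop. 2.2 once for `G′` resp. `∇G′` (`B8Ineq192FlatTorus.decay_mulVec_of_blockBound`).
[cite: Balaban1985BackgroundPropagators, Thm 3.1 (3.42) p.397, Thm 3.2 (3.48) p.398, (3.49) p.399; Balaban1984PropagatorsII, Prop. 2.2 p.234, Prop. 2.3 p.238] -/
theorem left_kernel_decay (d L : ℕ) (hd : 1 ≤ d) (hL : Odd L ∧ 1 < L) {a : ℝ} (ha : 0 < a) {msq : ℝ} (hmsq : 0 ≤ msq) :
    ∃ ρ A : ℝ, 0 < ρ ∧ 0 < A ∧ ∀ t : GpTopIdx d L, ∀ (x : Site t.P 0) (y' : Site t.P t.P.K),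
      |((tower t.P a msq).G t.P.K * Qks t.P t.P.K * (qggqK t.P a msq)⁻¹) x y'| ≤
          A * Real.exp (-(ρ * T1 t.P t.P.K (blk t.P t.P.K x) y')) ∧
      ∀ μ : Fin t.P.d, |(deriv t.P 0 t.P.eps μ * (tower t.P a msq).G t.P.K * Qks t.P t.P.K * (qggqK t.P a msq)⁻¹) x y'| ≤
          A * Real.exp (-(ρ * T1 t.P t.P.K (blk t.P t.P.K x) y')) := by
  obtain ⟨δ, C, hδ, hC, hBB⟩ := blockBounds_of_prop22 d L hd hL ha hmsq
  obtain ⟨δ₁, C₁, hδ₁, hC₁, hCinv⟩ := cinv_decay_of_prop23 d L hd hL ha hmsq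
  set ρ := min δ (δ₁ / 2) / 2 with hρ
  have hρ0 : 0 < ρ := by rw [hρ]; exact div_pos (lt_min hδ (half_pos hδ₁)) two_pos
  refine ⟨ρ, C * C₁ * B6.c0 ρ 1 ^ d, hρ0, mul_pos (mul_pos hC hC₁) (pow_pos (c0_pos hρ0) _), fun t x y' => ?_⟩
  obtain ⟨hG, hD, -⟩ := hBB t
  have hk₁b : ∀ w : Site t.P 0, |(fun w => (qggqK t.P a msq)⁻¹ (blk t.P t.P.K w) y') w| ≤
      C₁ * Real.exp (-(δ₁ / 2 * T1 t.P t.P.K (blk t.P t.P.K w) y')) := fun w => hCinv t _ _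
  have hcol0 : (fun w => (Qks t.P t.P.K * (qggqK t.P a msq)⁻¹) w y') =
      fun w => (qggqK t.P a msq)⁻¹ (blk t.P t.P.K w) y' := funext fun w => qks_mul_apply a msq _ w y'
  have key : ∀ {T : Matrix (Site t.P 0) (Site t.P 0) ℝ}, BlockBound t.P T C δ →
      |(T * Qks t.P t.P.K * (qggqK t.P a msq)⁻¹) x y'| ≤ C * C₁ * B6.c0 ρ 1 ^ d * Real.exp (-(ρ * T1 t.P t.P.K (blk t.P t.P.K x) y')) := by
    intro T hT
    have h := decay_mulVec_of_blockBound hC.le hδ hT hC₁.le (half_pos hδ₁) y' hk₁b x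
    rw [t.hPd] at h
    rw [Matrix.mul_assoc, mul_apply_eq_mulVec, hcol0]
    exact h
  exact ⟨key hG, fun μ => key (hD μ)⟩

/-! ## §4  (3.49) at U = 1, one scale, hypothesis-free -/

/-- the generic product step: a left kernel with decay `A e^{−ρ|y_x − y′|₁}` times a right kernel with `η^dCe^{−δ|y′ − y_{x′}|₁}`, summed over
`y′ ∈ 𝔅_k`, is `≦ A·C·c₀(ρ′)^d·η^d·e^{−ρ′|y_x − y_{x′}|₁}`. [cite: Balaban1985BackgroundPropagators, (3.49) p.399 («using again Lemma 2.1»); Balaban1984PropagatorsII, Lemma 2.1 (2.61) p.234] -/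
theorem abs_sum_left_right_le {Lk : Site P P.K → ℝ} {Rk : Site P P.K → ℝ} {A C ρ δ w : ℝ} (hA : 0 ≤ A) (hC : 0 ≤ C)
    (hw : 0 ≤ w) (hρ : 0 < ρ) (hδ : 0 < δ) (y y'' : Site P P.K)
    (hL : ∀ y', |Lk y'| ≤ A * Real.exp (-(ρ * T1 P P.K y y')))
    (hR : ∀ y', |Rk y'| ≤ w * C * Real.exp (-(δ * T1 P P.K y' y''))) :
    |∑ y', Lk y' * Rk y'| ≤ A * C * B6.c0 (min ρ δ / 2) 1 ^ P.d * w * Real.exp (-(min ρ δ / 2 * T1 P P.K y y'')) := by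
  calc |∑ y', Lk y' * Rk y'| ≤ ∑ y', |Lk y' * Rk y'| := Finset.abs_sum_le_sum_abs _ _
    _ ≤ ∑ y', A * Real.exp (-(ρ * T1 P P.K y y')) * (w * C * Real.exp (-(δ * T1 P P.K y' y''))) :=
        Finset.sum_le_sum fun y' _ => by
          rw [abs_mul]
          exact mul_le_mul (hL y') (hR y') (abs_nonneg _) (mul_nonneg hA (Real.exp_nonneg _))
    _ = A * C * w * ∑ y', Real.exp (-(ρ * T1 P P.K y y')) * Real.exp (-(δ * T1 P P.K y' y'')) := by
        rw [Finset.mul_sum]; exact Finset.sum_congr rfl fun y' _ => by ring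
    _ ≤ A * C * w * (B6.c0 (min ρ δ / 2) 1 ^ P.d * Real.exp (-(min ρ δ / 2 * T1 P P.K y y''))) :=
        mul_le_mul_of_nonneg_left (sum_exp_exp_le hρ hδ y y'') (by positivity)
    _ = A * C * B6.c0 (min ρ δ / 2) 1 ^ P.d * w * Real.exp (-(min ρ δ / 2 * T1 P P.K y y'')) := by ring

/-- **(3.49) AT U = 1 ON THE ONE-SCALE TORUS, HYPOTHESIS-FREE, ALL FOUR ENTRIES** — «|P(x,x′)|, |(DP)_μ(x,x′)|, |(PD\*)_ν(x,x′)|,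
|(DPD\*)_{μν}(x,x′)| ≦ O(1)[1, (Lʲη)⁻¹, (Lʲη)⁻¹, (Lʲη)⁻²](L^{j′}η)^{−d}e^{−½δ₀d(y,y′)}» with `Lʲη = L^{j′}η = 1` (one scale): there are `ρ > 0`,
`B > 0` depending on `d, L, a, m²` only such that on EVERY volume of the family (every `m`, every `K ≥ 1`), for all fine points `x, x′`
(in the blocks of `y_x`, `y_{x′}`) and all directions `μ, ν`, the GENUINE P = G′Q′\*(Q′G′²Q′\*)⁻¹Q′G′ (`pProjK`) satisfies
`|P(x,x′)|, |(D_μP)(x,x′)|, |(PD_νᵀ)(x,x′)|, |(D_μPD_νᵀ)(x,x′)| ≦ B·η^d·e^{−ρ|y_x − y_{x′}|₁}` — matrix entries, `η^d = (L^d)^{−K}` the weight of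
the fine pairing (so these are the printed kernel bounds for the pairing `Σ_x η^d`, p. 391).  Mechanism = the print's («These theorems imply …
using again Lemma 2.1») at the flat background: left factor `G′Q′*C⁻¹` / `DG′Q′*C⁻¹` by Prop. 2.3 + Prop. 2.2 (`left_kernel_decay`), right
factor `Q′G′` / `Q′G′D*` by Prop. 2.2 and `G′ᵀ = G′` (`abs_qkG_le`, `abs_qkGDt_le`), joined by Lemma 2.1 (`abs_sum_left_right_le`).
[cite: Balaban1985BackgroundPropagators, (3.49) p.399, (3.25) p.394, Thm 3.1 (3.42) p.397, Thm 3.2 (3.48) p.398; Balaban1984PropagatorsII, Prop. 2.2 p.234, Prop. 2.3 p.238, Lemma 2.1 (2.61) p.234] -/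
theorem ineq349_flat (d L : ℕ) (hd : 1 ≤ d) (hL : Odd L ∧ 1 < L) {a : ℝ} (ha : 0 < a) {msq : ℝ} (hmsq : 0 ≤ msq) :
    ∃ ρ B : ℝ, 0 < ρ ∧ 0 < B ∧ ∀ t : GpTopIdx d L, ∀ (x x' : Site t.P 0) (μ ν : Fin t.P.d),
      |pProjK t.P a msq x x'| ≤
          B * (((t.P.L : ℝ) ^ t.P.d)⁻¹) ^ t.P.K * Real.exp (-(ρ * T1 t.P t.P.K (blk t.P t.P.K x) (blk t.P t.P.K x'))) ∧
      |(deriv t.P 0 t.P.eps μ * pProjK t.P a msq) x x'| ≤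
          B * (((t.P.L : ℝ) ^ t.P.d)⁻¹) ^ t.P.K * Real.exp (-(ρ * T1 t.P t.P.K (blk t.P t.P.K x) (blk t.P t.P.K x'))) ∧
      |(pProjK t.P a msq * (deriv t.P 0 t.P.eps ν)ᵀ) x x'| ≤
          B * (((t.P.L : ℝ) ^ t.P.d)⁻¹) ^ t.P.K * Real.exp (-(ρ * T1 t.P t.P.K (blk t.P t.P.K x) (blk t.P t.P.K x'))) ∧
      |(deriv t.P 0 t.P.eps μ * pProjK t.P a msq * (deriv t.P 0 t.P.eps ν)ᵀ) x x'| ≤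
          B * (((t.P.L : ℝ) ^ t.P.d)⁻¹) ^ t.P.K * Real.exp (-(ρ * T1 t.P t.P.K (blk t.P t.P.K x) (blk t.P t.P.K x'))) := by
  obtain ⟨δ, C, hδ, hC, hBB⟩ := blockBounds_of_prop22 d L hd hL ha hmsq
  obtain ⟨ρ, A, hρ, hA, hLeft⟩ := left_kernel_decay d L hd hL ha hmsq
  set ρ' := min ρ δ / 2 with hρ'
  have hρ'0 : 0 < ρ' := by rw [hρ']; exact div_pos (lt_min hρ hδ) two_pos
  refine ⟨ρ', A * C * B6.c0 ρ' 1 ^ d, hρ'0, mul_pos (mul_pos hA hC) (pow_pos (c0_pos hρ'0) _), fun t x x' μ ν => ?_⟩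
  obtain ⟨hG, hD, -⟩ := hBB t
  have hPd : t.P.d = d := t.hPd
  have hw : (0 : ℝ) ≤ (((t.P.L : ℝ) ^ t.P.d)⁻¹) ^ t.P.K := by positivity
  -- the four factor bounds
  have hL0 := fun y' => (hLeft t x y').1
  have hL1 := fun y' => (hLeft t x y').2 μ
  have hR0 : ∀ y', |(Qk t.P t.P.K * (tower t.P a msq).G t.P.K) y' x'| ≤
      (((t.P.L : ℝ) ^ t.P.d)⁻¹) ^ t.P.K * C * Real.exp (-(δ * T1 t.P t.P.K y' (blk t.P t.P.K x'))) :=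
    fun y' => abs_qkG_le ha hmsq t.hK hG y' x'
  have hR1 : ∀ y', |(Qk t.P t.P.K * ((tower t.P a msq).G t.P.K * (deriv t.P 0 t.P.eps ν)ᵀ)) y' x'| ≤
      (((t.P.L : ℝ) ^ t.P.d)⁻¹) ^ t.P.K * C * Real.exp (-(δ * T1 t.P t.P.K y' (blk t.P t.P.K x'))) :=
    fun y' => abs_qkGDt_le ha hmsq t.hK ν (hD ν) y' x'
  -- generic assembly
  have assemble : ∀ {Lk Rk : Site t.P t.P.K → ℝ},
      (∀ y', |Lk y'| ≤ A * Real.exp (-(ρ * T1 t.P t.P.K (blk t.P t.P.K x) y'))) →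
      (∀ y', |Rk y'| ≤ (((t.P.L : ℝ) ^ t.P.d)⁻¹) ^ t.P.K * C * Real.exp (-(δ * T1 t.P t.P.K y' (blk t.P t.P.K x')))) →
      |∑ y', Lk y' * Rk y'| ≤ A * C * B6.c0 ρ' 1 ^ d * (((t.P.L : ℝ) ^ t.P.d)⁻¹) ^ t.P.K *
        Real.exp (-(ρ' * T1 t.P t.P.K (blk t.P t.P.K x) (blk t.P t.P.K x'))) := by
    intro Lk Rk hLk hRk
    have h := abs_sum_left_right_le hA.le hC.le hw hρ hδ (blk t.P t.P.K x) (blk t.P t.P.K x') hLk hRk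
    have hc : B6.c0 (min ρ δ / 2) 1 ^ t.P.d = B6.c0 ρ' 1 ^ d := by rw [hPd]
    rw [hc] at h
    exact h
  -- the four words as `left * right`
  have e0 : pProjK t.P a msq x x' = ∑ y', ((tower t.P a msq).G t.P.K * Qks t.P t.P.K * (qggqK t.P a msq)⁻¹) x y' *
      (Qk t.P t.P.K * (tower t.P a msq).G t.P.K) y' x' := by
    unfold pProjK; rw [Matrix.mul_apply]
  have e1 : (deriv t.P 0 t.P.eps μ * pProjK t.P a msq) x x' =
      ∑ y', (deriv t.P 0 t.P.eps μ * (tower t.P a msq).G t.P.K * Qks t.P t.P.K * (qggqK t.P a msq)⁻¹) x y' *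
        (Qk t.P t.P.K * (tower t.P a msq).G t.P.K) y' x' := by
    unfold pProjK
    rw [show deriv t.P 0 t.P.eps μ * ((tower t.P a msq).G t.P.K * Qks t.P t.P.K * (qggqK t.P a msq)⁻¹ *
        (Qk t.P t.P.K * (tower t.P a msq).G t.P.K)) =
        (deriv t.P 0 t.P.eps μ * (tower t.P a msq).G t.P.K * Qks t.P t.P.K * (qggqK t.P a msq)⁻¹) *
        (Qk t.P t.P.K * (tower t.P a msq).G t.P.K) by simp only [Matrix.mul_assoc], Matrix.mul_apply]
  have e2 : (pProjK t.P a msq * (deriv t.P 0 t.P.eps ν)ᵀ) x x' =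
      ∑ y', ((tower t.P a msq).G t.P.K * Qks t.P t.P.K * (qggqK t.P a msq)⁻¹) x y' *
        (Qk t.P t.P.K * ((tower t.P a msq).G t.P.K * (deriv t.P 0 t.P.eps ν)ᵀ)) y' x' := by
    unfold pProjK
    rw [show (tower t.P a msq).G t.P.K * Qks t.P t.P.K * (qggqK t.P a msq)⁻¹ * (Qk t.P t.P.K * (tower t.P a msq).G t.P.K) *
        (deriv t.P 0 t.P.eps ν)ᵀ = ((tower t.P a msq).G t.P.K * Qks t.P t.P.K * (qggqK t.P a msq)⁻¹) *
        (Qk t.P t.P.K * ((tower t.P a msq).G t.P.K * (deriv t.P 0 t.P.eps ν)ᵀ)) by simp only [Matrix.mul_assoc], Matrix.mul_apply]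
  have e3 : (deriv t.P 0 t.P.eps μ * pProjK t.P a msq * (deriv t.P 0 t.P.eps ν)ᵀ) x x' =
      ∑ y', (deriv t.P 0 t.P.eps μ * (tower t.P a msq).G t.P.K * Qks t.P t.P.K * (qggqK t.P a msq)⁻¹) x y' *
        (Qk t.P t.P.K * ((tower t.P a msq).G t.P.K * (deriv t.P 0 t.P.eps ν)ᵀ)) y' x' := by
    unfold pProjK
    rw [show deriv t.P 0 t.P.eps μ * ((tower t.P a msq).G t.P.K * Qks t.P t.P.K * (qggqK t.P a msq)⁻¹ *
        (Qk t.P t.P.K * (tower t.P a msq).G t.P.K)) * (deriv t.P 0 t.P.eps ν)ᵀ =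
        (deriv t.P 0 t.P.eps μ * (tower t.P a msq).G t.P.K * Qks t.P t.P.K * (qggqK t.P a msq)⁻¹) *
        (Qk t.P t.P.K * ((tower t.P a msq).G t.P.K * (deriv t.P 0 t.P.eps ν)ᵀ)) by simp only [Matrix.mul_assoc], Matrix.mul_apply]
  refine ⟨?_, ?_, ?_, ?_⟩
  · rw [e0]; exact assemble hL0 hR0
  · rw [e1]; exact assemble hL1 hR0
  · rw [e2]; exact assemble hL0 hR1
  · rw [e3]; exact assemble hL1 hR1

/-- **The same four entries for `R − 1 = −P`** (R = I − P, (3.25)): the off-identity part of the genuine one-scale projection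
`B8Ineq192FlatTorus.rProjK` has the (3.49) kernel bounds. [cite: Balaban1985BackgroundPropagators, (3.25) p.394, (3.49) p.399] -/
theorem ineq349_flat_R (d L : ℕ) (hd : 1 ≤ d) (hL : Odd L ∧ 1 < L) {a : ℝ} (ha : 0 < a) {msq : ℝ} (hmsq : 0 ≤ msq) :
    ∃ ρ B : ℝ, 0 < ρ ∧ 0 < B ∧ ∀ t : GpTopIdx d L, ∀ (x x' : Site t.P 0) (μ ν : Fin t.P.d),
      |(rProjK t.P a msq - 1) x x'| ≤
          B * (((t.P.L : ℝ) ^ t.P.d)⁻¹) ^ t.P.K * Real.exp (-(ρ * T1 t.P t.P.K (blk t.P t.P.K x) (blk t.P t.P.K x'))) ∧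
      |(deriv t.P 0 t.P.eps μ * (rProjK t.P a msq - 1)) x x'| ≤
          B * (((t.P.L : ℝ) ^ t.P.d)⁻¹) ^ t.P.K * Real.exp (-(ρ * T1 t.P t.P.K (blk t.P t.P.K x) (blk t.P t.P.K x'))) ∧
      |((rProjK t.P a msq - 1) * (deriv t.P 0 t.P.eps ν)ᵀ) x x'| ≤
          B * (((t.P.L : ℝ) ^ t.P.d)⁻¹) ^ t.P.K * Real.exp (-(ρ * T1 t.P t.P.K (blk t.P t.P.K x) (blk t.P t.P.K x'))) ∧
      |(deriv t.P 0 t.P.eps μ * (rProjK t.P a msq - 1) * (deriv t.P 0 t.P.eps ν)ᵀ) x x'| ≤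
          B * (((t.P.L : ℝ) ^ t.P.d)⁻¹) ^ t.P.K * Real.exp (-(ρ * T1 t.P t.P.K (blk t.P t.P.K x) (blk t.P t.P.K x'))) := by
  obtain ⟨ρ, B, hρ, hB, h⟩ := ineq349_flat d L hd hL ha hmsq
  refine ⟨ρ, B, hρ, hB, fun t x x' μ ν => ?_⟩
  have hRP : rProjK t.P a msq - 1 = -pProjK t.P a msq := by
    rw [rProjK_eq_one_sub_pProjK]; abel
  obtain ⟨h0, h1, h2, h3⟩ := h t x x' μ ν
  refine ⟨?_, ?_, ?_, ?_⟩
  · rw [hRP, Matrix.neg_apply, abs_neg]; exact h0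
  · rw [hRP, Matrix.mul_neg, Matrix.neg_apply, abs_neg]; exact h1
  · rw [hRP, Matrix.neg_mul, Matrix.neg_apply, abs_neg]; exact h2
  · rw [hRP, Matrix.mul_neg, Matrix.neg_mul, Matrix.neg_apply, abs_neg]; exact h3

-- Non-vacuity of the family (members for every `m`, `K ≥ 1`): `B8Ineq192FlatTorus.family_nonempty` (not restated).

end Literature.MathematicalPhysics.QuantumFieldTheory.Balaban1983to89.B9Ineq349FlatTorus

end
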